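import Summits.CriticalPhenomena.CardyFormulaZ2.Theorems.CardyComplexConeSLESixFamiliesGiveCardyDefs
import Literature.Probability.Percolation.BoxCrossingProofs
import HarnessLib

/-!
# Smooth-mark discretisation families, part 1: lattice frames and the frontier distance of boundary sites

Helper file for stub `stub_smoothMarkFamilies` (STATEMENT F `SmoothMarkFamilies`) of line
`collar-touch-sandwich` of crux `SLESixFamiliesGiveCardy` (stmt-CriticalPhenomena-9654).

* **Lattice frames.** Near a smooth mark the domain is, after a lattice rotation/reflection, the
  epigraph of a monotone function.  Instead of transporting the discrete structures we read sites
  in a FRAME `(k, s, t)`: the frame column of a site `x` is `s * x k` and its frame row is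
  `t * x k.rev` (`k : Fin 2`, `s t ∈ {1, -1}`); the corresponding complex frame vectors are
  `U = Site.toComplex (Pi.single k s)`, `V = Site.toComplex (Pi.single k.rev t)`, an orthonormal
  pair, and `meshPoint δ x = δ (col x) U + δ (row x) V`.  We record adjacency, face corners and
  mesh points in frame coordinates (eight-case coordinate checks).
* **Frontier distance.** Every site of the square-lattice discrete boundary `zdBoundary` of an open
  set has a frontier point within `2δ` of its mesh point (`exists_frontier_near_of_mem_zdBoundary`).
-/

noncomputable section

open Set Metric
open Literature.Probability Literature.Probability.RandomPlanarGeometry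
  Literature.Probability.LatticeModels Literature.Probability.Percolation

namespace Summit.CriticalPhenomena.CardyFormulaZ2.Cruxes.SLESixFamiliesGiveCardy.CollarTouchSandwich

/-! ### Coordinates on `ℤ²` -/

/-- `Fin.rev` on `Fin 2`: `rev 0 = 1`. [folklore] -/
@[simp] theorem fin_rev_zero : (0 : Fin 2).rev = 1 := by decide

/-- `Fin.rev` on `Fin 2`: `rev 1 = 0`. [folklore] -/
@[simp] theorem fin_rev_one : (1 : Fin 2).rev = 0 := by decide

/-- Adjacency in `ℤ²` in coordinates. [folklore] -/
theorem adj_iff_coord {x y : Site 2} : (zdGraph 2).Adj x y ↔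
    ((y 0 = x 0 + 1 ∨ y 0 + 1 = x 0) ∧ y 1 = x 1) ∨ ((y 1 = x 1 + 1 ∨ y 1 + 1 = x 1) ∧ y 0 = x 0) := by
  rw [zdGraph_adj_iff, Fin.exists_fin_two]
  simp only [funext_iff, Fin.forall_fin_two, Pi.add_apply, Pi.single_eq_same,
    Pi.single_eq_of_ne (one_ne_zero : (1 : Fin 2) ≠ 0),
    Pi.single_eq_of_ne (zero_ne_one : (0 : Fin 2) ≠ 1), add_zero]
  omega

/-- A corner of a face, in coordinates (definition unfolded on `Fin 2`). [folklore] -/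
theorem isCorner_iff_coord {w f : Site 2} :
    IsCorner w f ↔ (w 0 = f 0 ∨ w 0 = f 0 + 1) ∧ (w 1 = f 1 ∨ w 1 = f 1 + 1) := by
  unfold LatticeModels.IsCorner
  rw [Fin.forall_fin_two]

section Frame

variable (k : Fin 2) {s t : ℤ} (hs : s = 1 ∨ s = -1) (ht : t = 1 ∨ t = -1)
include hs ht

/-- **Adjacency in frame coordinates**: two sites are `ℤ²`-neighbours iff their frame columns
differ by one and their frame rows agree, or vice versa. [folklore] -/
theorem frame_adj_iff {x y : Site 2} : (zdGraph 2).Adj x y ↔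
    ((s * y k = s * x k + 1 ∨ s * y k + 1 = s * x k) ∧ t * y k.rev = t * x k.rev) ∨
      ((t * y k.rev = t * x k.rev + 1 ∨ t * y k.rev + 1 = t * x k.rev) ∧ s * y k = s * x k) := by
  rw [adj_iff_coord]
  fin_cases k <;> rcases hs with rfl | rfl <;> rcases ht with rfl | rfl <;> simp <;> omega

/-- A site is recovered from its frame coordinates. [folklore] -/
theorem frame_eq_self (x : Site 2) :
    (Pi.single k (s * (s * x k)) + Pi.single k.rev (t * (t * x k.rev)) : Site 2) = x := by
  funext i
  fin_cases k <;> fin_cases i <;> rcases hs with rfl | rfl <;> rcases ht with rfl | rfl <;> simp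

/-- The frame column of the site with frame coordinates `(j, n)` is `j`. [folklore] -/
theorem col_frameSite (j n : ℤ) :
    s * (Pi.single k (s * j) + Pi.single k.rev (t * n) : Site 2) k = j := by
  fin_cases k <;> rcases hs with rfl | rfl <;> rcases ht with rfl | rfl <;> simp

/-- The frame row of the site with frame coordinates `(j, n)` is `n`. [folklore] -/
theorem row_frameSite (j n : ℤ) :
    t * (Pi.single k (s * j) + Pi.single k.rev (t * n) : Site 2) k.rev = n := by
  fin_cases k <;> rcases hs with rfl | rfl <;> rcases ht with rfl | rfl <;> simp

/-- Two sites with the same frame coordinates are equal. [folklore] -/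
theorem eq_of_frame_eq {x y : Site 2} (h1 : s * x k = s * y k) (h2 : t * x k.rev = t * y k.rev) :
    x = y := by
  rw [← frame_eq_self k hs ht x, ← frame_eq_self k hs ht y, h1, h2]

/-- **Corners in frame coordinates.** `w` is a corner of the face `f` iff its frame column is the
frame column `s * f k + (s - 1) / 2` of the face or the next one, and likewise for rows. [folklore] -/
theorem frame_isCorner_iff {w f : Site 2} : IsCorner w f ↔
    (s * w k = s * f k + (s - 1) / 2 ∨ s * w k = s * f k + (s - 1) / 2 + 1) ∧
      (t * w k.rev = t * f k.rev + (t - 1) / 2 ∨ t * w k.rev = t * f k.rev + (t - 1) / 2 + 1) := by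
  rw [isCorner_iff_coord]
  fin_cases k <;> rcases hs with rfl | rfl <;> rcases ht with rfl | rfl <;> simp <;> omega

/-- Every pair of frame coordinates `(j, m)` is the frame coordinate pair of some face. [folklore] -/
theorem exists_face_frame (j m : ℤ) :
    ∃ f : Site 2, s * f k + (s - 1) / 2 = j ∧ t * f k.rev + (t - 1) / 2 = m := by
  refine ⟨Pi.single k (s * (j - (s - 1) / 2)) + Pi.single k.rev (t * (m - (t - 1) / 2)), ?_, ?_⟩ <;>
    fin_cases k <;> rcases hs with rfl | rfl <;> rcases ht with rfl | rfl <;> simp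

/-- **Mesh points in frame coordinates**: `δx = δ (col x) U + δ (row x) V` with the frame vectors
`U = Site.toComplex (Pi.single k s)`, `V = Site.toComplex (Pi.single k.rev t)`. [folklore] -/
theorem meshPoint_frame (δ : ℝ) (x : Site 2) :
    meshPoint δ x = ((δ * ((s * x k : ℤ) : ℝ) : ℝ) : ℂ) * Site.toComplex (Pi.single k s) +
      ((δ * ((t * x k.rev : ℤ) : ℝ) : ℝ) : ℂ) * Site.toComplex (Pi.single k.rev t) := by
  apply Complex.ext <;> fin_cases k <;> rcases hs with rfl | rfl <;> rcases ht with rfl | rfl <;>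
    simp [meshPoint, Site.toComplex]

/-- The frame vectors are orthonormal: `‖a U + b V‖² = a² + b²`. [folklore] -/
theorem frame_norm_sq (a b : ℝ) :
    ‖(a : ℂ) * Site.toComplex (Pi.single k s) + (b : ℂ) * Site.toComplex (Pi.single k.rev t)‖ ^ 2 =
      a ^ 2 + b ^ 2 := by
  rw [Complex.sq_norm, Complex.normSq_apply]
  fin_cases k <;> rcases hs with rfl | rfl <;> rcases ht with rfl | rfl <;>
    simp [Site.toComplex] <;> ring

/-- Every complex number has frame coordinates: `z = a U + b V` with `a = re (z conj U)`,
`b = re (z conj V)`. [folklore] -/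
theorem frame_decomp (z : ℂ) :
    z = (((z * (starRingEnd ℂ) (Site.toComplex (Pi.single k s))).re : ℝ) : ℂ) *
        Site.toComplex (Pi.single k s) +
      (((z * (starRingEnd ℂ) (Site.toComplex (Pi.single k.rev t))).re : ℝ) : ℂ) *
        Site.toComplex (Pi.single k.rev t) := by
  apply Complex.ext <;> fin_cases k <;> rcases hs with rfl | rfl <;> rcases ht with rfl | rfl <;>
    simp [Site.toComplex]

end Frame


/-! ### Lattice facts about faces -/

/-- Two corners of a face are within `2δ` of each other (`0 ≤ δ`). [folklore] -/
theorem dist_meshPoint_corners_le {δ : ℝ} (hδ : 0 ≤ δ) {v w f : Site 2} (hv : IsCorner v f)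
    (hw : IsCorner w f) : dist (meshPoint δ v) (meshPoint δ w) ≤ 2 * δ := by
  rw [isCorner_iff_coord] at hv hw
  rw [Complex.dist_eq]
  refine (Complex.norm_le_abs_re_add_abs_im _).trans ?_
  have h0 : |((v 0 : ℤ) : ℝ) - (w 0 : ℤ)| ≤ 1 := by
    rw [← Int.cast_sub, ← Int.cast_abs, ← Int.cast_one, Int.cast_le, abs_le]; omega
  have h1 : |((v 1 : ℤ) : ℝ) - (w 1 : ℤ)| ≤ 1 := by
    rw [← Int.cast_sub, ← Int.cast_abs, ← Int.cast_one, Int.cast_le, abs_le]; omega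
  simp only [Complex.sub_re, Complex.sub_im, meshPoint_re, meshPoint_im, ← mul_sub, abs_mul,
    abs_of_nonneg hδ]
  nlinarith

/-- In a face, a corner different from the two endpoints of a side is adjacent to one of them.
[folklore] -/
theorem adj_or_adj_of_isCorner {x v w f : Site 2} (hx : IsCorner x f) (hv : IsCorner v f)
    (hw : IsCorner w f) (hvw : (zdGraph 2).Adj v w) (hxv : x ≠ v) (hxw : x ≠ w) :
    (zdGraph 2).Adj x v ∨ (zdGraph 2).Adj x w := by
  rw [isCorner_iff_coord] at hx hv hw
  rw [adj_iff_coord] at hvw ⊢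
  rw [adj_iff_coord]
  have hxv' : ¬ (x 0 = v 0 ∧ x 1 = v 1) := fun h => hxv (funext fun i => by
    fin_cases i; exacts [h.1, h.2])
  have hxw' : ¬ (x 0 = w 0 ∧ x 1 = w 1) := fun h => hxw (funext fun i => by
    fin_cases i; exacts [h.1, h.2])
  rcases hx with ⟨hx0 | hx0, hx1 | hx1⟩ <;> rcases hv with ⟨hv0 | hv0, hv1 | hv1⟩ <;>
    rcases hw with ⟨hw0 | hw0, hw1 | hw1⟩ <;> omega

/-! ### Boundary sites are within `2δ` of the frontier -/

/-- A site of `Ω_δ` with a `ℤ²`-neighbour outside `Ω_δ`: the closed mesh edge between them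
contains a point outside `Ω` (either the neighbour's mesh point, or — if that lies in `Ω` — a point
where the edge leaves `Ω̄`, since otherwise the neighbour would be in the same mesh component).
[folklore] -/
theorem exists_not_mem_of_adj_not_mem_meshDomain {Ω : Set ℂ} {δ : ℝ} {x y : Site 2}
    (hx : x ∈ meshDomain Ω δ) (hxy : (zdGraph 2).Adj x y) (hy : y ∉ meshDomain Ω δ) :
    ∃ p ∈ segment ℝ (meshPoint δ x) (meshPoint δ y), p ∉ Ω := by
  by_cases hyΩ : meshPoint δ y ∈ Ω
  · have hna : ¬ (meshGraph Ω δ).Adj x y := fun h => hy (mem_meshDomain_of_meshGraph_adj hx hyΩ h)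
    rw [meshGraph_adj_iff, not_and] at hna
    obtain ⟨p, hp, hpc⟩ := not_subset.1 (hna hxy)
    exact ⟨p, hp, fun h => hpc (subset_closure h)⟩
  · exact ⟨_, right_mem_segment ℝ _ _, hyΩ⟩

/-- Two `ℤ²`-neighbours, at least one in `Ω_δ`, which are NOT joined in `Ω_δ`: their closed mesh
edge contains a point outside `Ω`. [folklore] -/
theorem exists_not_mem_of_not_adj {Ω : Set ℂ} {δ : ℝ} {v w : Site 2} (hvw : (zdGraph 2).Adj v w)
    (hn : ¬ (discreteDomainGraph Ω δ).Adj v w) (hv : v ∈ meshDomain Ω δ ∨ w ∈ meshDomain Ω δ) :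
    ∃ p ∈ segment ℝ (meshPoint δ v) (meshPoint δ w), p ∉ Ω := by
  rw [discreteDomainGraph_adj_iff] at hn
  by_cases hv' : v ∈ meshDomain Ω δ
  · by_cases hw' : w ∈ meshDomain Ω δ
    · have h' : ¬ (meshGraph Ω δ).Adj v w := fun h => hn ⟨h, hv', hw'⟩
      rw [meshGraph_adj_iff, not_and] at h'
      obtain ⟨p, hp, hpc⟩ := not_subset.1 (h' hvw)
      exact ⟨p, hp, fun h => hpc (subset_closure h)⟩
    · exact exists_not_mem_of_adj_not_mem_meshDomain hv' hvw hw'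
  · have hw' : w ∈ meshDomain Ω δ := hv.resolve_left hv'
    obtain ⟨p, hp, hpΩ⟩ := exists_not_mem_of_adj_not_mem_meshDomain hw' hvw.symm hv'
    refine ⟨p, ?_, hpΩ⟩
    rw [segment_symm]
    exact hp

/-- From a point of `Ω` to a point outside `Ω` within distance `r`: a frontier point within `r`.
[folklore] -/
theorem exists_frontier_of_not_mem {Ω : Set ℂ} (hΩ : IsOpen Ω) {z p : ℂ} (hz : z ∈ Ω) (hp : p ∉ Ω)
    {r : ℝ} (hr : dist z p ≤ r) : ∃ q ∈ frontier Ω, dist z q ≤ r := by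
  obtain ⟨q, hq, hqf⟩ := exists_mem_segment_frontier hΩ hz
    (fun h => hp (h (right_mem_segment ℝ z p)))
  refine ⟨q, hqf, le_trans ?_ hr⟩
  have := dist_add_dist_of_mem_segment hq
  linarith [dist_nonneg (x := q) (y := p)]

/-- **A corner in `Ω_δ` of a non-inner face has a frontier point within `2δ`.** Some side of the
face is not an edge of `Ω_δ`; its closed mesh edge, or the mesh edge from the corner to an
endpoint of it outside `Ω_δ`, contains a point outside `Ω` within `2δ` of the corner. [folklore] -/
theorem exists_frontier_near_of_not_isInnerFace {E : DiscreteDobrushin} (hΩ : IsOpen E.Ω)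
    (hδ : 0 ≤ E.δ) {x f : Site 2} (hx : x ∈ meshDomain E.Ω E.δ) (hxf : IsCorner x f)
    (hf : ¬ E.IsInnerFace f) : ∃ q ∈ frontier E.Ω, dist (meshPoint E.δ x) q ≤ 2 * E.δ := by
  have hxΩ : meshPoint E.δ x ∈ E.Ω := meshDomain_subset_meshVertices _ _ hx
  simp only [DiscreteDobrushin.IsInnerFace, not_forall, exists_prop] at hf
  obtain ⟨v, w, hv, hw, hvw, hn⟩ := hf
  -- a point outside `Ω` within `2δ` of `δx`
  obtain ⟨p, hpΩ, hpx⟩ : ∃ p, p ∉ E.Ω ∧ dist (meshPoint E.δ x) p ≤ 2 * E.δ := by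
    by_cases hmem : v ∈ meshDomain E.Ω E.δ ∨ w ∈ meshDomain E.Ω E.δ
    · obtain ⟨p, hp, hpΩ⟩ := exists_not_mem_of_not_adj hvw hn hmem
      refine ⟨p, hpΩ, ?_⟩
      have hsub : segment ℝ (meshPoint E.δ v) (meshPoint E.δ w) ⊆
          closedBall (meshPoint E.δ x) (2 * E.δ) :=
        (convex_closedBall _ _).segment_subset
          (by rw [mem_closedBall, dist_comm]; exact dist_meshPoint_corners_le hδ hxf hv)
          (by rw [mem_closedBall, dist_comm]; exact dist_meshPoint_corners_le hδ hxf hw)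
      have := hsub hp
      rwa [mem_closedBall, dist_comm] at this
    · push Not at hmem
      have hxv : x ≠ v := fun h => hmem.1 (h ▸ hx)
      have hxw : x ≠ w := fun h => hmem.2 (h ▸ hx)
      rcases adj_or_adj_of_isCorner hxf hv hw hvw hxv hxw with h | h
      · obtain ⟨p, hp, hpΩ⟩ := exists_not_mem_of_adj_not_mem_meshDomain hx h hmem.1
        refine ⟨p, hpΩ, ?_⟩
        have hsub : segment ℝ (meshPoint E.δ x) (meshPoint E.δ v) ⊆
            closedBall (meshPoint E.δ x) (2 * E.δ) :=
          (convex_closedBall _ _).segment_subset (mem_closedBall_self (by positivity))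
            (by rw [mem_closedBall, dist_comm]; exact dist_meshPoint_corners_le hδ hxf hv)
        have := hsub hp
        rwa [mem_closedBall, dist_comm] at this
      · obtain ⟨p, hp, hpΩ⟩ := exists_not_mem_of_adj_not_mem_meshDomain hx h hmem.2
        refine ⟨p, hpΩ, ?_⟩
        have hsub : segment ℝ (meshPoint E.δ x) (meshPoint E.δ w) ⊆
            closedBall (meshPoint E.δ x) (2 * E.δ) :=
          (convex_closedBall _ _).segment_subset (mem_closedBall_self (by positivity))
            (by rw [mem_closedBall, dist_comm]; exact dist_meshPoint_corners_le hδ hxf hw)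
        have := hsub hp
        rwa [mem_closedBall, dist_comm] at this
  exact exists_frontier_of_not_mem hΩ hxΩ hpΩ hpx

/-- **Every site of the square-lattice discrete boundary has a frontier point within `2δ`**
(a `meshBoundary` site has one on an incident closed mesh edge, an endpoint of a face-boundary
edge has one near its non-inner face). [folklore] -/
theorem exists_frontier_near_of_mem_zdBoundary {E : DiscreteDobrushin} (hΩ : IsOpen E.Ω)
    (hδ : 0 ≤ E.δ) {x : Site 2} (hx : x ∈ E.zdBoundary) :
    ∃ q ∈ frontier E.Ω, dist (meshPoint E.δ x) q ≤ 2 * E.δ := by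
  rcases hx with hx | ⟨y, hxy, -, f, hf, hxf, -⟩
  · obtain ⟨y, hxy, q, hq, hqf⟩ := exists_mem_frontier_of_mem_meshBoundary hΩ hx
    refine ⟨q, hqf, ?_⟩
    have hsub : segment ℝ (meshPoint E.δ x) (meshPoint E.δ y) ⊆ closedBall (meshPoint E.δ x) (2 * E.δ) :=
      (convex_closedBall _ _).segment_subset (mem_closedBall_self (by positivity))
        (by rw [mem_closedBall, dist_comm, dist_meshPoint_of_adj hxy, abs_of_nonneg hδ]; linarith)
    have := hsub hq
    rwa [mem_closedBall, dist_comm] at this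
  · exact exists_frontier_near_of_not_isInnerFace hΩ hδ (discreteDomainGraph_adj_iff.1 hxy).2.1 hxf hf

/-- Hence the distance from a boundary site to the frontier is at most `2δ`. [folklore] -/
theorem infDist_frontier_le_of_mem_zdBoundary {E : DiscreteDobrushin} (hΩ : IsOpen E.Ω)
    (hδ : 0 ≤ E.δ) {x : Site 2} (hx : x ∈ E.zdBoundary) :
    infDist (meshPoint E.δ x) (frontier E.Ω) ≤ 2 * E.δ := by
  obtain ⟨q, hq, hqd⟩ := exists_frontier_near_of_mem_zdBoundary hΩ hδ hx
  exact (infDist_le_dist_of_mem hq).trans hqd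

/-! ### Registered sub-goal (one-line signature, verbatim) -/

/-- **Registered sub-goal `smoothMark_part1` of `stub_smoothMarkFamilies`**: every site of the square-lattice discrete boundary of an open set is within `2δ` of the frontier. [folklore] -/
theorem smoothMark_part1 : ∀ (E : DiscreteDobrushin), IsOpen E.Ω → 0 ≤ E.δ → ∀ x ∈ E.zdBoundary, Metric.infDist (meshPoint E.δ x) (frontier E.Ω) ≤ 2 * E.δ :=
  fun _ hΩ hδ _ hx => infDist_frontier_le_of_mem_zdBoundary hΩ hδ hx

end Summit.CriticalPhenomena.CardyFormulaZ2.Cruxes.SLESixFamiliesGiveCardy.CollarTouchSandwich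

end
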